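import Literature.NumberTheory.GaloisRepresentations.LocalOneUnitsNumberFieldProofs
import Literature.NumberTheory.EllipticCurves.LocalPointsIntegersSubgroup
import Mathlib.NumberTheory.RamificationInertia.Basic
import Mathlib.NumberTheory.NumberField.Basic
import HarnessLib

/-!
# (I1) FROM POITOU–TATE, Side A at ALL layers, part 2: the RELATIVE local count
# `p^{k·[L:F]} ≤ ∏_{w ∣ v} #(𝓞_{L,w}/p^k)` for number fields `F ⊆ L` and a place `v ∋ p` of `F`

Route `ThetaPartnerAtTwo` (TP2) / `ResidualThetaTransportAtTwo` (RTT), PUB conjunction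
`PublishedInputsGreenbergControlAtTwo` (stmt-BirchSwinnertonDyer-24143, conj. 5) and K4 `SignedControlAtTwo`
(stmt-BirchSwinnertonDyer-20309); seat `bsd-inputs-r1-p1` (D-0154 (2) INPUTS row 1, input (I1)
`WeierstrassCurve.relaxedSelmer_torsion_card_growth` = Greenberg LNM 1716 Thm. 1.7 / p. 62). Companion of
`…RelaxedKummerCountMultiPlace` (`∏_{𝔮∈Q} #(𝓞_𝔮/p^k) ≤ #H¹_{𝓛, ⊤ at Q}(K, E[p^k]) · ∏_{w∣∞} #H¹(K_w, E)`): the local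
factor `∏_{w∣v} #(𝓞_{L,w}/p^k)` at the places of a layer `L` above ONE place `v` of the base is `≥ p^{k[L:F]}`.

* `prime_le_natCard_quot_asIdeal` (`p ≤ #(𝓞_F/v)` at `v ∋ p`), `natCard_quot_map_asIdeal`
  (`#(𝓞_L/v𝓞_L) = #(𝓞_F/v)^{[L:F]}`, Mathlib `Ideal.finrank_quotient_map`), `liesOver_of_dvd_map`;
* `prime_pow_mul_finrank_le_prod_natCard_quot` — **`p^{k·[L:F]} ≤ ∏_{w ∈ T} #(𝓞_{L,w}/p^k)`** for number fields
  `F ⊆ L`, `v ∋ p` a place of `F`, `T ⊇ {w ∣ v𝓞_L}`: the map `𝓞_L → ∏_{w ∈ T} 𝓞_{L,w}/p^k` has kernel inside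
  `(v𝓞_L)^k = ⨅_w w^{k·ord_w(v𝓞_L)}` (`Ideal.iInf_maxPowDividing_eq`; at `w ∣ v𝓞_L`, `x ∈ p^k𝓞_{L,w}` reads
  `ord_w(x) ≥ k·ord_w(p) ≥ k·ord_w(v𝓞_L)` as `p ∈ v𝓞_L`), so `#∏ ≥ N((v𝓞_L)^k) = #(𝓞_F/v)^{k[L:F]} ≥ p^{k[L:F]}`
  — the finite-level form of `∑_{w∣v} [L_w:ℚ_p] = [L:F]·[F_v:ℚ_p] ≥ [L:F]` (Greenberg LNM 1716 p. 62,
  "`corank_{ℤ_p} Sel_E(F_n)_p ≥ r(E,F)pⁿ`");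
(The assembly with the multi-place count of `…RelaxedKummerCountMultiPlace` —
`p^{k·[L:F]} ≤ #kummerOutside E_L (p^k) {w ∣ v} · ∏_{w∣∞} #H¹(L_w, E_L)` from `poitouTate_selmerStructure_duality L` — and
the transport to (I1) are the sequel `…RelaxedKummerCountAllLevels`; this file is pure algebraic number theory.)

HONEST FRAMING: THEOREMS ONLY (no definition, no named fact, no `sorry`), unconditional arithmetic of number fields;
closes nothing by itself; BSD is not proved by any of this.

References: [cite: GreenbergLNM1716, Thm 1.7 and the paragraph after it (pp. 61–62)] [cite: MilneADT2006, Ch. I,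
Lemma 3.3, Thm. 4.10] [cite: NeukirchANT1999, Ch. I (8.2), Ch. II (8.4)] [cite: NeukirchSchmidtWingberg2008, (8.7.9)].
-/

set_option linter.dupNamespace false

noncomputable section
open scoped Classical
open NumberField IsDedekindDomain Function
open Literature.NumberTheory.EllipticCurves Literature.NumberTheory.GaloisRepresentations
namespace Summit.BirchSwinnertonDyer.BirchSwinnertonDyer.Theorems.SignedEC.RelaxedKummerCount

variable (p : ℕ) [Fact p.Prime]

/-! ## §3 The relative local count `p^{k·[L:F]} ≤ ∏_{w ∣ v} #(𝓞_{L,w}/p^k)` -/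

section Relative

variable (F L : Type) [Field F] [NumberField F] [Field L] [NumberField L] [Algebra F L]

omit [Fact p.Prime] in
/-- `p ≤ #(𝓞_F/v)` at a place `v ∋ p`: the residue field is a non-trivial ring in which `p = 0`, so the
additive order `p` of `1` divides its order. [folklore] -/
theorem prime_le_natCard_quot_asIdeal [Fact p.Prime] (v : HeightOneSpectrum (𝓞 F))
    (hv : (p : 𝓞 F) ∈ v.asIdeal) : p ≤ Nat.card (𝓞 F ⧸ v.asIdeal) := by
  have hprime : p.Prime := Fact.out
  haveI : Finite (𝓞 F ⧸ v.asIdeal) := Ideal.finiteQuotientOfFreeOfNeBot _ v.ne_bot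
  haveI : Nontrivial (𝓞 F ⧸ v.asIdeal) :=
    Ideal.Quotient.nontrivial_iff.mpr v.isMaximal.ne_top
  have h0 : (p : 𝓞 F ⧸ v.asIdeal) = 0 := by
    rw [← map_natCast (Ideal.Quotient.mk v.asIdeal) p, Ideal.Quotient.eq_zero_iff_mem]
    exact hv
  have h1 : addOrderOf (1 : 𝓞 F ⧸ v.asIdeal) = p := by
    have hdvd : addOrderOf (1 : 𝓞 F ⧸ v.asIdeal) ∣ p := by
      rw [addOrderOf_dvd_iff_nsmul_eq_zero, nsmul_one]
      exact h0
    rcases (Nat.dvd_prime hprime).mp hdvd with h | h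
    · exact absurd (AddMonoid.addOrderOf_eq_one_iff.mp h) one_ne_zero
    · exact h
  have h2 := addOrderOf_dvd_natCard (1 : 𝓞 F ⧸ v.asIdeal)
  rw [h1] at h2
  exact Nat.le_of_dvd Nat.card_pos h2

omit [Fact p.Prime] in
/-- `#(𝓞_L / v𝓞_L) = #(𝓞_F / v)^{[L:F]}` for number fields `F ⊆ L` and a finite place `v` of `F`
(`𝓞_L/v𝓞_L` is an `𝓞_F/v`-vector space of dimension `[L:F]`, Mathlib `Ideal.finrank_quotient_map`).
Neukirch, *ANT* I (8.2). [folklore] -/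
theorem natCard_quot_map_asIdeal (v : HeightOneSpectrum (𝓞 F)) :
    Nat.card (𝓞 L ⧸ v.asIdeal.map (algebraMap (𝓞 F) (𝓞 L))) =
      Nat.card (𝓞 F ⧸ v.asIdeal) ^ Module.finrank F L := by
  haveI : v.asIdeal.IsMaximal := v.isMaximal
  letI : Field (𝓞 F ⧸ v.asIdeal) := Ideal.Quotient.field v.asIdeal
  haveI : Module.Finite (𝓞 F ⧸ v.asIdeal) (𝓞 L ⧸ v.asIdeal.map (algebraMap (𝓞 F) (𝓞 L))) :=
    Module.Finite.of_restrictScalars_finite (𝓞 F) (𝓞 F ⧸ v.asIdeal)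
      (𝓞 L ⧸ v.asIdeal.map (algebraMap (𝓞 F) (𝓞 L)))
  rw [← Ideal.finrank_quotient_map (S := 𝓞 L) v.asIdeal F L]
  exact Module.natCard_eq_pow_finrank

omit [Fact p.Prime] [NumberField F] [NumberField L] in
/-- `algebraMap (𝓞 F) (𝓞 L)` is injective. [folklore] -/
theorem algebraMap_ringOfIntegers_injective : Injective (algebraMap (𝓞 F) (𝓞 L)) := by
  have h : Injective (algebraMap (𝓞 F) L) := by
    rw [IsScalarTower.algebraMap_eq (𝓞 F) F L, RingHom.coe_comp]
    exact (algebraMap F L).injective.comp RingOfIntegers.coe_injective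
  rw [IsScalarTower.algebraMap_eq (𝓞 F) (𝓞 L) L, RingHom.coe_comp] at h
  exact h.of_comp

omit [Fact p.Prime] [NumberField L] in
/-- A prime `w` of `𝓞 L` dividing `v𝓞_L` lies over `v`. [folklore] -/
theorem liesOver_of_dvd_map (v : HeightOneSpectrum (𝓞 F)) (w : HeightOneSpectrum (𝓞 L))
    (h : w.asIdeal ∣ v.asIdeal.map (algebraMap (𝓞 F) (𝓞 L))) : w.asIdeal.LiesOver v.asIdeal := by
  refine ⟨(v.isMaximal.eq_of_le ?_ (Ideal.map_le_iff_le_comap.mp (Ideal.le_of_dvd h))).trans rfl⟩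
  exact Ideal.comap_ne_top _ w.isPrime.ne_top

/-- **The relative local count `p^{k·[L:F]} ≤ ∏_{w ∈ T} #(𝓞_{L,w}/p^k)`** for number fields `F ⊆ L`, a
finite place `v ∋ p` of `F` and any finite set `T` of finite places of `L` containing every `w ∣ v𝓞_L`.
Proof: `𝓞_L → ∏_{w ∈ T} 𝓞_{L,w}/p^k` has kernel inside `(v𝓞_L)^k`: at `w ∣ v𝓞_L`, `x ∈ p^k 𝓞_{L,w}` reads
`ord_w(x) ≥ k·ord_w(p) ≥ k·ord_w(v𝓞_L)` (since `p ∈ v𝓞_L`), and `(v𝓞_L)^k = ⨅_w w^{k·ord_w(v𝓞_L)}`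
(`Ideal.iInf_maxPowDividing_eq`); hence `#∏ ≥ #(𝓞_L/(v𝓞_L)^k) = N(v𝓞_L)^k = #(𝓞_F/v)^{k[L:F]} ≥ p^{k[L:F]}`.
This is the finite-level form of Greenberg's `∑_{w∣v} [L_w:ℚ_p] = [L:F]·[F_v:ℚ_p] ≥ [L:F]` (LNM 1716 p. 62,
`corank Sel_E(F_n)_p ≥ r(E,F)·pⁿ`). [cite: NeukirchANT1999, Ch. I (8.2), Ch. II (8.4)]
[cite: GreenbergLNM1716, Thm 1.7 and the paragraph after it (pp. 61–62)] -/
theorem prime_pow_mul_finrank_le_prod_natCard_quot (v : HeightOneSpectrum (𝓞 F)) (hv : (p : 𝓞 F) ∈ v.asIdeal)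
    (k : ℕ) (T : Finset (HeightOneSpectrum (𝓞 L)))
    (hT : ∀ w : HeightOneSpectrum (𝓞 L), w.asIdeal ∣ v.asIdeal.map (algebraMap (𝓞 F) (𝓞 L)) → w ∈ T) :
    p ^ (k * Module.finrank F L) ≤
      ∏ w ∈ T, Nat.card (w.adicCompletionIntegers L ⧸
        Ideal.span {((p ^ k : ℕ) : w.adicCompletionIntegers L)}) := by
  classical
  have hprime : p.Prime := Fact.out
  set I₁ : Ideal (𝓞 L) := v.asIdeal.map (algebraMap (𝓞 F) (𝓞 L)) with hI₁def
  have hI₁ : I₁ ≠ ⊥ := by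
    rw [hI₁def, Ne, Ideal.map_eq_bot_iff_of_injective (algebraMap_ringOfIntegers_injective F L)]
    exact v.ne_bot
  set I : Ideal (𝓞 L) := I₁ ^ k with hIdef
  have hI : I ≠ ⊥ := pow_ne_zero k hI₁
  have hpI₁ : ((p : ℕ) : 𝓞 L) ∈ I₁ := by
    rw [← map_natCast (algebraMap (𝓞 F) (𝓞 L)) p]
    exact Ideal.mem_map_of_mem _ hv
  have hp0 : ((p : ℕ) : 𝓞 L) ≠ 0 := by exact_mod_cast hprime.ne_zero
  -- §a the count of `𝓞_L / I`
  have hcardI : p ^ (k * Module.finrank F L) ≤ Nat.card (𝓞 L ⧸ I) := by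
    rw [← Submodule.cardQuot_apply, ← Ideal.absNorm_apply, hIdef, map_pow, Ideal.absNorm_apply,
      Submodule.cardQuot_apply, natCard_quot_map_asIdeal F L v, ← pow_mul, mul_comm]
    exact Nat.pow_le_pow_left (prime_le_natCard_quot_asIdeal p F v hv) _
  -- §b the comparison map and its kernel
  let Φ : 𝓞 L →+* ∀ w : T, (w.1.adicCompletionIntegers L ⧸
      Ideal.span {((p ^ k : ℕ) : w.1.adicCompletionIntegers L)}) :=
    RingHom.pi fun w => (Ideal.Quotient.mk _).comp (algebraMap (𝓞 L) (w.1.adicCompletionIntegers L))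
  have hΦ_apply : ∀ (a : 𝓞 L) (w : T),
      Φ a w = Ideal.Quotient.mk _ (algebraMap (𝓞 L) (w.1.adicCompletionIntegers L) a) := fun _ _ ↦ rfl
  have hker : ∀ x : 𝓞 L, Φ x = 0 → x ∈ I := by
    intro x hx
    rw [← Ideal.iInf_maxPowDividing_eq hI, Submodule.mem_iInf]
    intro w
    change x ∈ w.asIdeal ^ (Associates.mk w.asIdeal).count (Associates.mk I).factors
    rw [← HeightOneSpectrum.intValuation_le_pow_iff_mem]
    have hcount : (Associates.mk w.asIdeal).count (Associates.mk I).factors =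
        k * (Associates.mk w.asIdeal).count (Associates.mk I₁).factors := by
      rw [hIdef, Associates.mk_pow, Associates.count_pow (Associates.mk_ne_zero.mpr hI₁) w.associates_irreducible]
    by_cases hw : w.asIdeal ∣ I₁
    · have hx0 : Φ x ⟨w, hT w hw⟩ = 0 := by rw [hx]; rfl
      rw [hΦ_apply, Ideal.Quotient.eq_zero_iff_mem, Ideal.mem_span_singleton] at hx0
      have h2 := (Valuation.Integers.dvd_iff_le (Valuation.valuationSubring.integers _)).1 hx0
      change Valued.v ((algebraMap (𝓞 L) (w.adicCompletionIntegers L) x : w.adicCompletion L)) ≤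
        Valued.v ((((p ^ k : ℕ) : w.adicCompletionIntegers L) : w.adicCompletionIntegers L) :
          w.adicCompletion L) at h2
      have hpk : Valued.v ((((p ^ k : ℕ) : w.adicCompletionIntegers L) : w.adicCompletionIntegers L) :
          w.adicCompletion L) = (w.intValuation ((p : ℕ) : 𝓞 L)) ^ k := by
        rw [← OneUnits.valued_natCast_adicCompletionIntegers L w p, ← map_pow]
        congr 1
        push_cast
        rfl
      rw [OneUnits.valued_algebraMap_adicCompletionIntegers, hpk, w.intValuation_if_neg hp0,
        ← WithZero.exp_nsmul, smul_neg, nsmul_eq_mul] at h2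
      refine h2.trans (WithZero.exp_le_exp.mpr (neg_le_neg ?_))
      rw [hcount]
      push_cast
      refine mul_le_mul_of_nonneg_left ?_ (Nat.cast_nonneg k)
      exact_mod_cast Associates.count_le_count_of_le
        (Associates.mk_ne_zero.mpr (by rw [Ne, Ideal.zero_eq_bot, Ideal.span_singleton_eq_bot]; exact hp0))
        w.associates_irreducible
        (Associates.mk_le_mk_iff_dvd.mpr (Ideal.dvd_iff_le.mpr ((Ideal.span_singleton_le_iff_mem _).mpr hpI₁)))
    · have h0 : (Associates.mk w.asIdeal).count (Associates.mk I₁).factors = 0 := by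
        by_contra hne
        exact hw ((Associates.count_ne_zero_iff_dvd hI₁ w.irreducible).mp hne)
      rw [hcount, h0, mul_zero, Nat.cast_zero, neg_zero, WithZero.exp_zero]
      exact w.intValuation_le_one x
  -- §c counting: `#(𝓞_L/I) ≤ #(𝓞_L/ker Φ) = #(range Φ) ≤ #(∏_{w∈T} 𝓞_{L,w}/p^k)`
  haveI hfinT : ∀ w : T, Finite (w.1.adicCompletionIntegers L ⧸
      Ideal.span {((p ^ k : ℕ) : w.1.adicCompletionIntegers L)}) := fun w ↦
    Nat.finite_of_card_ne_zero (LocalPoints.card_quotient_span_natCast_ne_zero w.1 (pow_ne_zero k hprime.ne_zero))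
  haveI : Finite (𝓞 L ⧸ RingHom.ker Φ) := Finite.of_equiv _ (RingHom.quotientKerEquivRange Φ).symm.toEquiv
  let ψ : 𝓞 L ⧸ RingHom.ker Φ →+* 𝓞 L ⧸ I :=
    Ideal.Quotient.lift (RingHom.ker Φ) (Ideal.Quotient.mk I) fun x hx ↦
      (Ideal.Quotient.eq_zero_iff_mem).mpr (hker x ((RingHom.mem_ker).mp hx))
  have hψ : Surjective ψ := by
    intro q
    obtain ⟨y, rfl⟩ := Ideal.Quotient.mk_surjective q
    exact ⟨Ideal.Quotient.mk _ y, by rw [Ideal.Quotient.lift_mk]⟩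
  calc p ^ (k * Module.finrank F L) ≤ Nat.card (𝓞 L ⧸ I) := hcardI
    _ ≤ Nat.card (𝓞 L ⧸ RingHom.ker Φ) := Nat.card_le_card_of_surjective ψ hψ
    _ = Nat.card Φ.range := Nat.card_congr (RingHom.quotientKerEquivRange Φ).toEquiv
    _ ≤ Nat.card (∀ w : T, (w.1.adicCompletionIntegers L ⧸
          Ideal.span {((p ^ k : ℕ) : w.1.adicCompletionIntegers L)})) :=
        Nat.card_le_card_of_injective _ Subtype.val_injective
    _ = _ := by rw [Nat.card_pi, Finset.prod_coe_sort T (fun w ↦ Nat.card (w.adicCompletionIntegers L ⧸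
          Ideal.span {((p ^ k : ℕ) : w.adicCompletionIntegers L)}))]

end Relative

end Summit.BirchSwinnertonDyer.BirchSwinnertonDyer.Theorems.SignedEC.RelaxedKummerCount

end
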